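import Summits.CriticalPhenomena.CardyFormulaZ2.Theses.CardyFlipRusso
import Summits.CriticalPhenomena.CardyFormulaZ2.Theses.CardySectorGap
import Summits.CriticalPhenomena.CardyFormulaZ2.Theorems.CardyFlipRussoTargetStubGsDictionary
import Literature.Probability.Percolation.SiteEmbDomainCrossing
import HarnessLib

/-!
# Vocabulary of line `five-arm-null` for the crux `CardyFlipRusso.CoveringLeg` (stmt-CriticalPhenomena-6435)

Route `CardyFlipRusso` (sub-problem `CriticalPhenomena/CardyFormulaZ2`), crux
`Summit.CriticalPhenomena.CardyFormulaZ2.Theses.CardyFlipRusso.CoveringLeg` (item stmt-CriticalPhenomena-6435):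
Cardy's formula for critical SITE percolation on Beffara's centred square lattice `G_s = ℤ² ⊔ (ℤ² + (½,½))`
(crude `2δ`-slack discretisation, unrotated frame, law `sitePercolation _ half`) IMPLIES Cardy's formula for
critical BOND percolation on `ℤ²` in the crude discretisation `embDomainCrossing squareLatticeEmbedding.z`.

**Definitions module** of the checked skeleton `Cruxes/CoveringLeg/Lines/five_arm_null.lean` (lead
`prover-line-stmt-CriticalPhenomena-6435-a1-0`; registered stubs `stub_frameBridge`, `stub_integratedLabelFlipNull`,
`stub_domainShiftBalance` = stmt-7053, `stub_russoQDerivative` = stmt-10401, `stub_coveringBridge` = stmt-7055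
BY NAME). Sorry-free VOCABULARY in the two frames in play — the crux's unrotated frame (`gS`, `siteProb`,
`bondProb`, `SiteCardy`, `BondCardy`; embedding = the tree's `centredSquareEmbedding`, literally the crux's
`let z`) and route CardySectorGap's covering-adapted frame (`gsGraph`, `zS`, `lawP`, `crossS`, `pivS`,
`massII`, `massIII`, `MixedCardyZero`, verbatim that route's `let`s) — the `Iff.rfl` CERTIFICATES tying every
named statement to the route decls, the two new stub STATEMENTS `Sig.stub_frameBridge`,
`Sig.stub_integratedLabelFlipNull` (`def … : Prop`, to be PROVED by helper files
`Theorems/CardyFlipRussoCoveringLeg<Stub>.lean --supports stmt-CriticalPhenomena-6435`; nothing is asserted here)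
and the pure-logic glue (`vertexFacePivotalBalance_of`, `integratedLabelFlipNull_of`, `mixedCardyZero_of`,
`CoveringLeg_of_stubs`), so that helper files and the closing skeleton share ONE copy of every object.

Mathematics (cards `Cruxes/CoveringLeg/Ideas/five-arm-null.md`, `Lines/five-arm-null.md`): bond-`ℤ²` is the
endpoint `q = 0` of Beffara's mixed family `P_{1/2,q} = prodBernoulli (mixedParam q)` on `G_s` (Kesten's
covering graph), `q = ½` is the crux hypothesis' model; by Russo `∂_q P_q[cross] = E_q N_II − E_q N_III`,
split into the integrated LABEL-FLIP null at one site class (`C⁺`, load-bearing) and a one-mesh DOMAIN SHIFT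
(stmt-7053); `C⁺ ⟺ stmt-7049` modulo stmt-7053 (both directions below). Exact facts: both frames' graphs ARE
the tree's `centredSquareGraph` (`gS_eq`, `gsGraph_eq`); at `q = ½` the mixed law IS `sitePercolation _ half`
(`lawP_half`); `z' = ((1 − i)·z + i)/√2` (`zS_inl`, `zS_inr`) with a non-period translation (`frame_offset`).

Sources: V. Beffara, *Is critical 2D percolation universal?*, Progr. Probab. 60 (2008) §5.1–5.2, Prop. 18
[Beffara2008Universal]; H. Kesten, *Percolation theory for mathematicians* (1982) §3.4 [Kesten1982].
-/

noncomputable section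

namespace Summit.CriticalPhenomena.CardyFormulaZ2.Cruxes.CoveringLeg.FiveArmNull

open scoped Classical
open Filter Set Topology
open Literature.Probability.RandomPlanarGeometry Literature.Probability.Percolation
open Literature.Probability.LatticeModels
open Literature.Barriers.CriticalPhenomena (MixedSite mixedParam)
open Summit.CriticalPhenomena.CardyFormulaZ2.Theses
-- buildfix lane 2026-08-20: `cardyFunction` is ambiguous in this cone (RandomPlanarGeometry vs Percolation copies);
-- namespace-local alias to the constant route `CardyFlipRusso` uses. No declaration text changes.
export Literature.Probability.RandomPlanarGeometry (cardyFunction)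

/-! ### Vocabulary A — the crux's own frame (its `let`s named; `z` = the tree's `centredSquareEmbedding`) -/

/-- `G_s` by distances: `ℤ²`-edges of length `1`, centre-to-corner edges of length `√2/2 < 1`
(verbatim the `let G` of the crux, over `centredSquareEmbedding`). [cite: Beffara2008Universal, §5.1] -/
def gS : SimpleGraph MixedSite :=
  SimpleGraph.fromRel (fun a b : (ℤ × ℤ) ⊕ (ℤ × ℤ) ↦ a.isLeft = true ∧
    ((b.isLeft = true ∧ dist (centredSquareEmbedding a) (centredSquareEmbedding b) = 1) ∨
      (b.isRight = true ∧ dist (centredSquareEmbedding a) (centredSquareEmbedding b) < 1)))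

/-- The metric graph of the crux IS the tree's combinatorial `centredSquareGraph`
(landed dictionary `stub_gsDictionary` of the crux `Target`). [cite: Beffara2008Universal, §5.1] -/
theorem gS_eq : gS = centredSquareGraph :=
  Summit.CriticalPhenomena.CardyFormulaZ2.Theorems.CardyFlipRussoTarget.stub_gsDictionary

/-- Crude site crossing probability of `R` at mesh `δ`, site percolation at `½` on `G_s`, unrotated
frame (the antecedent's family of the crux; the event is `siteEmbDomainCrossing gS centredSquareEmbedding …`
by `rfl`). [cite: Beffara2008Universal, §5.1] -/
def siteProb (R : ConformalRectangle) (δ : ℝ) : ℝ :=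
  (sitePercolation ((ℤ × ℤ) ⊕ (ℤ × ℤ)) half).real
    {ω | ∃ u v, Metric.infDist ((δ : ℂ) * centredSquareEmbedding u) (R.arc 0) ≤ 2 * δ ∧
      Metric.infDist ((δ : ℂ) * centredSquareEmbedding v) (R.arc 2) ≤ 2 * δ ∧
      ω ∈ siteConnIn gS {y | (δ : ℂ) * centredSquareEmbedding y ∈ R.carrier} u v}

/-- The antecedent's event is the tree's `siteEmbDomainCrossing` of `gS` (by `rfl`). [cite: Smirnov2001, §2] -/
theorem siteProb_eq (R : ConformalRectangle) (δ : ℝ) :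
    siteProb R δ = (sitePercolation MixedSite half).real
      (siteEmbDomainCrossing gS centredSquareEmbedding R.carrier δ (R.arc 0) (R.arc 2)) :=
  rfl

/-- Crude bond crossing probability of `R` at mesh `δ`, bond percolation on `ℤ²` at `½`
(`embDomainCrossing`, the consequent's family of the crux and of `CardySectorGap.CoveringBridge`).
[cite: GrimmettManolescu2014, §2.2] -/
def bondProb (R : ConformalRectangle) (δ : ℝ) : ℝ :=
  (bondPercolation (zdGraph 2) half).real
    (embDomainCrossing squareLatticeEmbedding.z R.carrier δ (R.arc 0) (R.arc 2))

/-- The antecedent of the crux: Cardy for crude site-`G_s` crossings, unrotated frame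
(= the second conjunct of `CardyFlipRusso.Target`, `siteCardy_of_target`). A route-posited OPEN statement
(named hypothesis of the line, not a literature fact). -/
def SiteCardy : Prop :=
  ∀ R : ConformalRectangle, R.HasCrossingLimit (siteProb R) cardyFunction

/-- The consequent of the crux: Cardy for crude bond-`ℤ²` crossings (Schramm's Problem 2.11 in the crude
discretisation). A route-posited OPEN statement (named conclusion of the line, not a literature fact). -/
def BondCardy : Prop :=
  ∀ R : ConformalRectangle, R.HasCrossingLimit (bondProb R) cardyFunction

/-- CERTIFICATE: the crux is literally `SiteCardy → BondCardy` (the `let`s zeta-reduce; the tree's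
`centredSquareEmbedding` is the crux's `let z` verbatim). [cite: Beffara2008Universal, §5.1] -/
theorem coveringLeg_iff : CardyFlipRusso.CoveringLeg ↔ (SiteCardy → BondCardy) :=
  Iff.rfl

/-- CERTIFICATE: the crux hypothesis is the second conjunct of the route's `Target` (so
`Sig.stub_frameBridge` is also the link `CardyFlipRusso.Target.2 → CardySectorGap.CardyCentredSquare`
between the two routes' "Cardy on `G_s`" items, stmt-6431 ↔ stmt-7048). [cite: Beffara2008Universal, §5.1] -/
theorem siteCardy_of_target (h : CardyFlipRusso.Target) : SiteCardy :=
  h.2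

/-! ### Vocabulary B — the frame of route CardySectorGap (its `let`s, VERBATIM, named)

Everything from here on is stated in this frame so that three stubs are CardySectorGap's items by name. -/

/-- `G_s` combinatorially (verbatim the `let Gs` of every CardySectorGap item). [cite: Beffara2008Universal, §5.1] -/
def gsGraph : SimpleGraph MixedSite :=
  SimpleGraph.fromRel (fun u v => (∃ x y : ℤ × ℤ, u = Sum.inl x ∧ v = Sum.inl y ∧ (x.1 - y.1) ^ 2 + (x.2 - y.2) ^ 2 = 1) ∨ (∃ x f : ℤ × ℤ, u = Sum.inl x ∧ v = Sum.inr f ∧ (x.1 = f.1 ∨ x.1 = f.1 + 1) ∧ (x.2 = f.2 ∨ x.2 = f.2 + 1)))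

/-- CardySectorGap's combinatorial graph IS the tree's `centredSquareGraph` as well (so both frames
percolate on one graph: `gS = gsGraph`). [cite: Beffara2008Universal, §5.1] -/
theorem gsGraph_eq : gsGraph = centredSquareGraph := by
  ext a b
  simp only [gsGraph, SimpleGraph.fromRel_adj, centredSquareGraph_adj_iff]
  refine and_congr_right fun _ => ?_
  have key : ∀ u v : MixedSite,
      ((∃ x y : ℤ × ℤ, u = Sum.inl x ∧ v = Sum.inl y ∧ (x.1 - y.1) ^ 2 + (x.2 - y.2) ^ 2 = 1) ∨
        (∃ x f : ℤ × ℤ, u = Sum.inl x ∧ v = Sum.inr f ∧ (x.1 = f.1 ∨ x.1 = f.1 + 1) ∧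
          (x.2 = f.2 ∨ x.2 = f.2 + 1))) ↔
      ((∃ x : ℤ × ℤ, u = Sum.inl x ∧
          (v = Sum.inl (x.1 + 1, x.2) ∨ v = Sum.inl (x.1, x.2 + 1) ∨
            ∃ f : ℤ × ℤ, v = Sum.inr f ∧ (x.1 = f.1 ∨ x.1 = f.1 + 1) ∧ (x.2 = f.2 ∨ x.2 = f.2 + 1))) ∨
        (∃ y : ℤ × ℤ, v = Sum.inl y ∧ (u = Sum.inl (y.1 + 1, y.2) ∨ u = Sum.inl (y.1, y.2 + 1)))) := by
    intro u v
    constructor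
    · rintro (⟨x, y, rfl, rfl, h⟩ | ⟨x, f, rfl, rfl, h⟩)
      · rcases (Summit.CriticalPhenomena.CardyFormulaZ2.Theorems.CardyFlipRussoTarget.int_sq_add_sq_eq_one_iff
            (x.1 - y.1) (x.2 - y.2)).1 h with ⟨h1, h2⟩ | ⟨h1, h2⟩ | ⟨h1, h2⟩ | ⟨h1, h2⟩
        · right; refine ⟨y, rfl, Or.inl ?_⟩
          obtain ⟨y1, y2⟩ := y; obtain ⟨x1, x2⟩ := x
          simp only [Sum.inl.injEq, Prod.mk.injEq] at h1 h2 ⊢; omega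
        · left; refine ⟨x, rfl, Or.inl ?_⟩
          obtain ⟨y1, y2⟩ := y; obtain ⟨x1, x2⟩ := x
          simp only [Sum.inl.injEq, Prod.mk.injEq] at h1 h2 ⊢; omega
        · right; refine ⟨y, rfl, Or.inr ?_⟩
          obtain ⟨y1, y2⟩ := y; obtain ⟨x1, x2⟩ := x
          simp only [Sum.inl.injEq, Prod.mk.injEq] at h1 h2 ⊢; omega
        · left; refine ⟨x, rfl, Or.inr (Or.inl ?_)⟩
          obtain ⟨y1, y2⟩ := y; obtain ⟨x1, x2⟩ := x
          simp only [Sum.inl.injEq, Prod.mk.injEq] at h1 h2 ⊢; omega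
      · exact Or.inl ⟨x, rfl, Or.inr (Or.inr ⟨f, rfl, h⟩)⟩
    · rintro (⟨x, rfl, h | h | ⟨f, rfl, h⟩⟩ | ⟨y, rfl, h | h⟩)
      · exact Or.inl ⟨x, _, rfl, h, by ring⟩
      · exact Or.inl ⟨x, _, rfl, h, by ring⟩
      · exact Or.inr ⟨x, f, rfl, rfl, h⟩
      · exact Or.inl ⟨_, y, h, rfl, by ring⟩
      · exact Or.inl ⟨_, y, h, rfl, by ring⟩
  rw [key a b, key b a]
  constructor
  · rintro ((h | ⟨y, rfl, h⟩) | (h | ⟨y, rfl, h⟩))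
    · exact Or.inl h
    · exact Or.inr ⟨y, rfl, by tauto⟩
    · exact Or.inr h
    · exact Or.inl ⟨y, rfl, by tauto⟩
  · rintro (h | h)
    · exact Or.inl (Or.inl h)
    · exact Or.inr (Or.inl h)

/-- The two frames percolate on the same graph. [cite: Beffara2008Universal, §5.1] -/
theorem gS_eq_gsGraph : gS = gsGraph := by
  rw [gS_eq, gsGraph_eq]

/-- The covering-adapted embedding `z' = ((1 − i)·z + i)/√2` (verbatim the `let z` of CardySectorGap):
type-I sites at the ODD points of `ℤ[i]/√2`, face centres at the EVEN ones, type-III centres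
(`f.1 + f.2` odd) exactly on `√2·ℤ[i]` = the image of `squareLatticeEmbedding.z`. [cite: Beffara2008Universal, §5.1] -/
def zS : MixedSite → ℂ :=
  fun u => Sum.elim (fun x : ℤ × ℤ => (((x.1 + x.2 : ℤ) : ℂ) + ((x.2 - x.1 + 1 : ℤ) : ℂ) * Complex.I) / (Real.sqrt 2 : ℂ)) (fun f : ℤ × ℤ => (((f.1 + f.2 + 1 : ℤ) : ℂ) + ((f.2 - f.1 + 1 : ℤ) : ℂ) * Complex.I) / (Real.sqrt 2 : ℂ)) u

/-- Beffara's mixed law `P_{1/2,q} = prodBernoulli (mixedParam q)` (verbatim the `let P` of CardySectorGap).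
[cite: Beffara2008Universal, §5.1] -/
def lawP : unitInterval → MeasureTheory.Measure (Set MixedSite) :=
  fun q => prodBernoulli (mixedParam q)

/-- The crude crossing event of `R` at mesh `δ` in the covering-adapted frame (verbatim the `let cross`).
[cite: Beffara2008Universal, §5.2] -/
def crossS (R : ConformalRectangle) : ℝ → Set (Set MixedSite) :=
  fun δ => {ω | ∃ u v, Metric.infDist ((δ : ℂ) * zS u) (R.arc 0) ≤ 2 * δ ∧ Metric.infDist ((δ : ℂ) * zS v) (R.arc 2) ≤ 2 * δ ∧ ω ∈ siteConnIn gsGraph {y | (δ : ℂ) * zS y ∈ R.carrier} u v}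

/-- The covering-frame event is the tree's `siteEmbDomainCrossing` of `gsGraph, zS` (by `rfl`). [cite: Smirnov2001, §2] -/
theorem crossS_eq (R : ConformalRectangle) (δ : ℝ) :
    crossS R δ = siteEmbDomainCrossing gsGraph zS R.carrier δ (R.arc 0) (R.arc 2) :=
  rfl

/-- Pivotality of the site `v` for the crude crossing (Beffara Def. 17; verbatim the `let piv`).
[cite: Beffara2008Universal, §5.2 Def. 17] -/
def pivS (R : ConformalRectangle) : ℝ → MixedSite → Set (Set MixedSite) :=
  fun δ v => {ω | insert v ω ∈ crossS R δ ∧ ω \ {v} ∉ crossS R δ}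

/-- The type-II pivotal mass `Σ_{f even} P_q(inr f pivotal)` (the finitely supported `tsum` of
stmt-7049/7053, verbatim). [cite: Beffara2008Universal, §5.2 Prop. 18] -/
def massII (R : ConformalRectangle) (q : unitInterval) (δ : ℝ) : ℝ :=
  ∑' f : ℤ × ℤ, if Even (f.1 + f.2) then (lawP q).real (pivS R δ (Sum.inr f)) else 0

/-- The type-III pivotal mass `Σ_{f odd} P_q(inr f pivotal)` (as in stmt-7049/7053, verbatim).
[cite: Beffara2008Universal, §5.2 Prop. 18] -/
def massIII (R : ConformalRectangle) (q : unitInterval) (δ : ℝ) : ℝ :=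
  ∑' f : ℤ × ℤ, if Even (f.1 + f.2) then 0 else (lawP q).real (pivS R δ (Sum.inr f))

/-- Cardy for the crude mixed crossing at `q = 0` (Kesten's covering encoding of bond-`ℤ²`): the
antecedent of `CardySectorGap.CoveringBridge`. A route-posited OPEN statement (not a literature fact). -/
def MixedCardyZero : Prop :=
  ∀ R : ConformalRectangle, R.HasCrossingLimit (fun δ => (lawP 0).real (crossS R δ)) cardyFunction

/-! ### Certificates: the shared items ARE these texts (`Iff.rfl`) -/

/-- stmt-7049 in this vocabulary. [cite: Beffara2008Universal, §5.2 eq. (5.1)] -/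
theorem vertexFacePivotalBalance_iff :
    CardySectorGap.VertexFacePivotalBalance ↔
      ∀ R : ConformalRectangle, ∀ ε : ℝ, 0 < ε → ∃ δ₀ : ℝ, 0 < δ₀ ∧ ∀ δ : ℝ, 0 < δ → δ < δ₀ →
        ∀ q : unitInterval, |massII R q δ - massIII R q δ| < ε :=
  Iff.rfl

/-- stmt-7053 in this vocabulary. [cite: Beffara2008Universal, §5.2 eq. (almost)] -/
theorem domainShiftBalance_iff :
    CardySectorGap.DomainShiftBalance ↔
      ∀ R : ConformalRectangle, ∀ ε : ℝ, 0 < ε → ∃ δ₀ : ℝ, 0 < δ₀ ∧ ∀ δ : ℝ, 0 < δ → δ < δ₀ →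
        ∀ q : unitInterval, |massIII R q δ - massII R (unitInterval.symm q) δ| < ε :=
  Iff.rfl

/-- stmt-7048 in this vocabulary. [cite: Beffara2008Universal, §5.1] -/
theorem cardyCentredSquare_iff :
    CardySectorGap.CardyCentredSquare ↔
      ∀ R : ConformalRectangle, R.HasCrossingLimit (fun δ => (lawP half).real (crossS R δ)) cardyFunction :=
  Iff.rfl

/-- stmt-7050 in this vocabulary. [cite: Beffara2008Universal, §5.2] -/
theorem mixedInterpolation_iff :
    CardySectorGap.MixedInterpolation ↔
      ∀ R : ConformalRectangle,
        Tendsto (fun δ : ℝ => (lawP half).real (crossS R δ) - (lawP 0).real (crossS R δ)) (𝓝[>] 0) (𝓝 0) :=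
  Iff.rfl

/-- stmt-10401 is literally `stmt-7049 → stmt-7050`. [cite: Beffara2008Universal, §5.2 Prop. 18] -/
theorem russoQDerivative_iff :
    CardySectorGap.RussoQDerivative ↔
      (CardySectorGap.VertexFacePivotalBalance → CardySectorGap.MixedInterpolation) :=
  Iff.rfl

/-- stmt-7055 is literally `MixedCardyZero → BondCardy` (its consequent is the crux's consequent).
[cite: Kesten1982, §3.4] -/
theorem coveringBridge_iff : CardySectorGap.CoveringBridge ↔ (MixedCardyZero → BondCardy) :=
  Iff.rfl

/-! ### Checked remarks on the two frames -/

/-- At `q = ½` Beffara's parameters are constant `½` (type III: `1 − ½ = ½`). [cite: Beffara2008Universal, §5.1] -/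
theorem mixedParam_half : mixedParam half = fun _ => half := by
  funext v
  cases v with
  | inl x => rfl
  | inr f =>
    simp only [mixedParam, Literature.Barriers.CriticalPhenomena.unitInterval_symm_half, ite_self]

/-- Hence the CardySectorGap law at `q = ½` IS the crux hypothesis' law `sitePercolation _ half`
(the laws of the two frames agree exactly; only the embeddings differ). [cite: Beffara2008Universal, §5.1] -/
theorem lawP_half : lawP half = sitePercolation MixedSite half := by
  simp only [lawP, mixedParam_half, prodBernoulli_const, sitePercolation]

/-- The frame offset: `z' = ((1 − i)·z + i)/√2` on type-I sites … [cite: Beffara2008Universal, §5.1] -/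
theorem zS_inl (x : ℤ × ℤ) :
    zS (Sum.inl x) =
      ((1 - Complex.I) * centredSquareEmbedding (Sum.inl x) + Complex.I) / (Real.sqrt 2 : ℂ) := by
  have h : (((x.1 + x.2 : ℤ) : ℂ) + ((x.2 - x.1 + 1 : ℤ) : ℂ) * Complex.I) =
      (1 - Complex.I) * ((x.1 : ℂ) + (x.2 : ℂ) * Complex.I) + Complex.I := by
    push_cast
    linear_combination (x.2 : ℂ) * Complex.I_sq
  simp only [zS, centredSquareEmbedding_inl, Sum.elim_inl, h]

/-- … and on face centres: the SAME affine map, whose translation part `i/√2` is not a period of the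
embedded lattice, so at mesh `δ` the two discretisations differ by the translation `δ·i/√2` after the
rotation — the content of `Sig.stub_frameBridge`. [cite: Beffara2008Universal, §5.1] -/
theorem zS_inr (f : ℤ × ℤ) :
    zS (Sum.inr f) =
      ((1 - Complex.I) * centredSquareEmbedding (Sum.inr f) + Complex.I) / (Real.sqrt 2 : ℂ) := by
  have h : (((f.1 + f.2 + 1 : ℤ) : ℂ) + ((f.2 - f.1 + 1 : ℤ) : ℂ) * Complex.I) =
      (1 - Complex.I) * (((f.1 : ℂ) + 1 / 2) + ((f.2 : ℂ) + 1 / 2) * Complex.I) + Complex.I := by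
    push_cast
    linear_combination ((f.2 : ℂ) + 1 / 2) * Complex.I_sq
  simp only [zS, centredSquareEmbedding_inr, Sum.elim_inr, h]

/-- The origin of the covering-adapted frame is a (type-III) face centre, whereas the origin of the
crux's frame is a type-I site: no relabelling of `G_s` makes the two embedded lattices coincide.
[cite: Beffara2008Universal, §5.1] -/
theorem frame_offset : zS (Sum.inr (0, -1)) = 0 ∧ centredSquareEmbedding (Sum.inl (0, 0)) = 0 := by
  constructor
  · simp [zS]
  · simp

/-! ### The two new stub statements (`Sig.stub_X` is the statement of the registered `stub_X`)

The other three registered stubs are CardySectorGap's decls `DomainShiftBalance` (stmt-7053),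
`RussoQDerivative` (stmt-10401), `CoveringBridge` (stmt-7055) BY NAME. Nothing is asserted here. -/

/-- STUB 1 — **FRAME BRIDGE at `q = ½`**. Cardy for crude site-`G_s` crossings in the crux's unrotated
frame (`SiteCardy`) implies Cardy for crude site-`G_s` crossings in CardySectorGap's covering-adapted frame
(`CardySectorGap.CardyCentredSquare`, stmt-7048). Exact parts: the laws agree (`lawP_half`), the graphs agree
(`gS_eq_gsGraph`), and `z' = ρ ∘ z + i/√2` with `ρ` the rotation by `−π/4` (`zS_inl`, `zS_inr`), so the
frame-B event of `(R, δ)` is the frame-A event of the rigid image `ρ⁻¹(R − δ·i/√2)` at mesh `δ`; the `o(1)`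
part is translation-robustness of crude crossing probabilities of site-`G_s` at `½` under an `O(δ)` shift of
`Ω` relative to the lattice (RSW in the boundary collar). Registered stub STATEMENT (nothing asserted). -/
def Sig.stub_frameBridge : Prop :=
  SiteCardy → CardySectorGap.CardyCentredSquare

/-- STUB 2 — **THE INTEGRATED LABEL-FLIP NULL `C⁺`** (load-bearing). For every conformal rectangle `R`:
`∀ ε > 0 ∃ δ₀ > 0 ∀ δ ∈ (0, δ₀) ∀ q ∈ [0,1]`, `|Σ_{f even} P_q(inr f pivotal) − Σ_{f even} P_{1−q}(inr f
pivotal)| < ε` — the type-II pivotal mass of the crude crossing of `R` is the same under `P_q` and `P_{1−q}`,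
uniformly in `q`, with NO rate and NO `δ/dist` weight. Equivalent to stmt-7049 given stmt-7053
(`vertexFacePivotalBalance_of`, `integratedLabelFlipNull_of`); exact (`= 0`) at `q = ½`; its only possible
non-zero limit is the exactly marginal colour-odd five-arm channel `b₅(q)·G₅^{odd}(Ω; abcd)` of the card.
Registered stub STATEMENT (nothing asserted). -/
def Sig.stub_integratedLabelFlipNull : Prop :=
  ∀ R : ConformalRectangle, ∀ ε : ℝ, 0 < ε → ∃ δ₀ : ℝ, 0 < δ₀ ∧ ∀ δ : ℝ, 0 < δ → δ < δ₀ →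
    ∀ q : unitInterval, |massII R q δ - massII R (unitInterval.symm q) δ| < ε

/-! ### Glue (pure logic on three reals / one `Tendsto.sub`) -/

/-- **`C⁺` + stmt-7053 ⇒ stmt-7049** (`VertexFacePivotalBalance`): `|X − Y| ≤ |X − Z| + |Z − Y|` with
`X = Σ_II P_q`, `Y = Σ_III P_q`, `Z = Σ_II P_{1−q}`; `ε/2` each, `δ₀ = min δ₁ δ₂`. No summability is
needed (the masses enter as three real numbers). [cite: Beffara2008Universal, §5.2] -/
theorem vertexFacePivotalBalance_of (hN : Sig.stub_integratedLabelFlipNull)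
    (hS : CardySectorGap.DomainShiftBalance) : CardySectorGap.VertexFacePivotalBalance := by
  rw [vertexFacePivotalBalance_iff]; rw [domainShiftBalance_iff] at hS
  intro R ε hε
  obtain ⟨δ₁, hδ₁, h₁⟩ := hN R (ε / 2) (half_pos hε)
  obtain ⟨δ₂, hδ₂, h₂⟩ := hS R (ε / 2) (half_pos hε)
  refine ⟨min δ₁ δ₂, lt_min hδ₁ hδ₂, fun δ hδ hδlt q => ?_⟩
  have a := h₁ δ hδ (lt_of_lt_of_le hδlt (min_le_left _ _)) q
  have b := h₂ δ hδ (lt_of_lt_of_le hδlt (min_le_right _ _)) q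
  rw [abs_sub_comm] at b
  calc |massII R q δ - massIII R q δ|
      ≤ |massII R q δ - massII R (unitInterval.symm q) δ|
          + |massII R (unitInterval.symm q) δ - massIII R q δ| := abs_sub_le _ _ _
    _ < ε / 2 + ε / 2 := add_lt_add a b
    _ = ε := add_halves ε

/-- Conversely **stmt-7049 + stmt-7053 ⇒ `C⁺`**: the load-bearing stub is EQUIVALENT to stmt-7049 modulo
stmt-7053 (Beffara's split made explicit), not a new conjecture. [cite: Beffara2008Universal, §5.2] -/
theorem integratedLabelFlipNull_of (hV : CardySectorGap.VertexFacePivotalBalance)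
    (hS : CardySectorGap.DomainShiftBalance) : Sig.stub_integratedLabelFlipNull := by
  rw [vertexFacePivotalBalance_iff] at hV; rw [domainShiftBalance_iff] at hS
  intro R ε hε
  obtain ⟨δ₁, hδ₁, h₁⟩ := hV R (ε / 2) (half_pos hε)
  obtain ⟨δ₂, hδ₂, h₂⟩ := hS R (ε / 2) (half_pos hε)
  refine ⟨min δ₁ δ₂, lt_min hδ₁ hδ₂, fun δ hδ hδlt q => ?_⟩
  have a := h₁ δ hδ (lt_of_lt_of_le hδlt (min_le_left _ _)) q
  have b := h₂ δ hδ (lt_of_lt_of_le hδlt (min_le_right _ _)) q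
  calc |massII R q δ - massII R (unitInterval.symm q) δ|
      ≤ |massII R q δ - massIII R q δ| + |massIII R q δ - massII R (unitInterval.symm q) δ| :=
        abs_sub_le _ _ _
    _ < ε / 2 + ε / 2 := add_lt_add a b
    _ = ε := add_halves ε

/-- `C⁺` is symmetric under `q ↔ 1 − q` (so uniformity over `[0,1]` costs nothing beyond `[0,½]`).
[cite: Beffara2008Universal, §5.1] -/
theorem massII_sub_symm (R : ConformalRectangle) (q : unitInterval) (δ : ℝ) :
    |massII R (unitInterval.symm q) δ - massII R (unitInterval.symm (unitInterval.symm q)) δ| =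
      |massII R q δ - massII R (unitInterval.symm q) δ| := by
  rw [unitInterval.symm_symm, abs_sub_comm]

/-- `C⁺` is trivially exact at `q = ½`. [cite: Beffara2008Universal, §5.1] -/
theorem massII_sub_half (R : ConformalRectangle) (δ : ℝ) :
    massII R half δ - massII R (unitInterval.symm half) δ = 0 := by
  rw [Literature.Barriers.CriticalPhenomena.unitInterval_symm_half, sub_self]

/-- **stmt-7048 + stmt-7050 ⇒ Cardy for the crude `P_0` crossing** (one `Tendsto.sub` inside each
uniformizing datum; the argument of `CardySectorGap.closes`). [cite: Beffara2008Universal, §5.2] -/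
theorem mixedCardyZero_of (hC : CardySectorGap.CardyCentredSquare)
    (hM : CardySectorGap.MixedInterpolation) : MixedCardyZero := by
  rw [cardyCentredSquare_iff] at hC; rw [mixedInterpolation_iff] at hM
  intro R φ x hφ
  have h3 := (hC R φ x hφ).sub (hM R)
  simp only [sub_sub_cancel, sub_zero] at h3
  exact h3

/-- **The composition of the line** (glue only): frame bridge + integrated label-flip null +
domain-shift balance + Russo in `q` + Kesten's covering bridge imply `CoveringLeg`; the crux hypothesis
`hSite` is consumed by the frame bridge. [cite: Beffara2008Universal, §5.1–5.2] -/
theorem CoveringLeg_of_stubs : Summit.CriticalPhenomena.CardyFormulaZ2.Cruxes.CoveringLeg.FiveArmNull.Sig.stub_frameBridge → Summit.CriticalPhenomena.CardyFormulaZ2.Cruxes.CoveringLeg.FiveArmNull.Sig.stub_integratedLabelFlipNull → Summit.CriticalPhenomena.CardyFormulaZ2.Theses.CardySectorGap.DomainShiftBalance → Summit.CriticalPhenomena.CardyFormulaZ2.Theses.CardySectorGap.RussoQDerivative → Summit.CriticalPhenomena.CardyFormulaZ2.Theses.CardySectorGap.CoveringBridge → Summit.CriticalPhenomena.CardyFormulaZ2.Theses.CardyFlipRusso.CoveringLeg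 := by
  intro hF hN hS hR hB
  refine coveringLeg_iff.2 fun hSite => ?_
  have hC : CardySectorGap.CardyCentredSquare := hF hSite
  have hV : CardySectorGap.VertexFacePivotalBalance := vertexFacePivotalBalance_of hN hS
  have hM : CardySectorGap.MixedInterpolation := (russoQDerivative_iff.1 hR) hV
  exact (coveringBridge_iff.1 hB) (mixedCardyZero_of hC hM)

end Summit.CriticalPhenomena.CardyFormulaZ2.Cruxes.CoveringLeg.FiveArmNull

end
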